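import Literature.AlgebraicGeometry.Pohlmann1968.CMFamilyRankPartition
import Literature.NumberTheory.ComplexMultiplication.CMTypeRankTwoBlocks
import HarnessLib

/-!
# Full additivity of a family of CM types is HEREDITARY and SPLITS INTO BLOCKS: `Hg(∏_i A_i) = ∏_i Hg(A_i)` forces
# `Hg(∏_i A_i) = ∏_c Hg(∏_{κ i = c} A_i)`, `Hg(∏_{i ∈ T} A_i) = ∏_{i ∈ T} Hg(A_i)` and `Hg(X × Y) = Hg(X) × Hg(Y)`

COR-CM (cell `pub-hodgecm2`, binder seat `b16` gen 60, count-neutral claim HODGE GLUING, file G1 — abstract `G`-set level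
and CM fields; theorems only, no definition, no named fact, no `sorry`).  NEW as stated, hence under `Summits/`.
HONEST FRAMING: unconditional arithmetic of Kubota ranks of families of CM types (read on Mumford–Tate groups of
products of CM abelian varieties); `HC_CM` is neither used nor asserted.

A family `(Φ_i)_{i ∈ I}` of CM types (for a conjugation `ρ`, on finite `G`-slots `E_i`) is ADDITIVE when
`rank(Σ) + |I| = Σ_i rank(Φ_i) + 1`, i.e. `dim U(Σ) = Σ_i dim U(Φ_i)` — on abelian varieties `dim MT(∏_i A_i) − 1 =
Σ_i (dim MT(A_i) − 1)`, `Hg(∏_i A_i) = ∏_i Hg(A_i)`, the members ARBITRARY (degenerate allowed).  The tree supplies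
additivity from many Galois hypotheses (pointwise partial conjugations `PointwiseConjugationCMFieldsHodge`, pairwise
`ρ`-separation `IrreducibleOddWeightsSeparatedSlots`, disjoint or totally-real-meeting Galois closures, reflex pairs …) and
its two a-priori inequalities `rank(Σ) + |C| ≤ Σ_c rank(Σ|_c) + 1` (`typeRank_sigmaType_add_card_le_fiber`, every
partition `κ : I ↠ C`) and `rank(Σ|_c) + |I_c| ≤ Σ_{i ∈ I_c} rank(Φ_i) + 1` (`typeRank_sigmaType_add_card_le`).  Summing the
second over the blocks and chaining with the first gives back exactly `rank(Σ) + |I| ≤ Σ_i rank(Φ_i) + 1`; so when the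
family is additive EVERY intermediate inequality is an equality:

* §1 (abstract) **`IrrOdd.typeRank_sigmaType_fiber_add_card_eq_of_add_card_eq`** — additivity over `I` ⟹ additivity
  OVER THE BLOCKS of every partition (`rank(Σ) + |C| = Σ_c rank(Σ|_c) + 1`, `Hg(∏_i A_i) = ∏_c Hg(∏_{I_c} A_i)`) AND
  additivity INSIDE every block (`rank(Σ|_c) + |I_c| = Σ_{I_c} rank(Φ_i) + 1`); **`…_subtype_add_card_eq_of_add_card_eq`**
  — every sub-family `(Φ_i)_{p i}` of an additive family is additive (HEREDITARY); **`IrrOdd.typeRank_sum_add_one_eq_of_add_card_eq`**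
  — the TWO-BLOCK form `rank(Σ|_p ⊔ Σ|_{¬p}) + 1 = rank(Σ|_p) + rank(Σ|_{¬p})` (`Hg(X × Y) = Hg(X) × Hg(Y)` for
  `X = ∏_{p i} A_i`, `Y = ∏_{¬p i} A_i`), which is the hypothesis of the tree's product-span theorem
  `Pohlmann1968.hodgeClassesProductSpan_biproduct_of_typeRank_add` (Moonen–Zarhin (3.1) ⟸).
* §2 (CM fields, `cmFamilyRank`) the same three statements: `cmFamilyRank_fiber_add_card_eq_of_add_card_eq`,
  `cmFamilyRank_subtype_add_card_eq_of_add_card_eq`, `typeRank_sum_add_one_eq_cmFamilyRank_of_add_card_eq`.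

The sequel `IrreducibleOddWeightsHodgeGluing` turns them into the Hodge conjecture on every `∏_j A_{π j}` from the Hodge
conjecture on the powers of the members, for every additive family.

## References

* [MoonenZarhin1999LowDim] B. Moonen, Yu. Zarhin, *Hodge classes on abelian varieties of low dimension*, Math. Ann.
  315 (1999), §3 (3.1).
* [Gordon1999HodgeAVSurvey] B. B. Gordon, *A survey of the Hodge conjecture for abelian varieties*, §3 Theorem (Imai,
  Murty) and 7.5–7.7.
* [Deligne1982HodgeCycles] P. Deligne, *Hodge cycles on abelian varieties*, LNM 900 (1982), I Ex. 3.7.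

Provenance: Literature home (family `hodge`, namespace `Literature.AlgebraicGeometry.ComplexMultiplication.BlockAdditivity`) of the Summits-side `CorCM/IrreducibleOddWeightsBlockAdditivity` (cell `pub-hodgecm2`, COR-CM; all its imports are `Literature/` and Mathlib), which `Literature/` may not import; theorems only, no named fact, no definition. Nothing here bears on `HC_CM`. Lane `lit-hodgefound` (Layer A3: CM types, their Kubota ranks and Galois combinatorics), seat p20.
-/

set_option autoImplicit false

noncomputable section

open scoped BigOperators

open NumberField

namespace Literature.AlgebraicGeometry.ComplexMultiplication.BlockAdditivity

namespace IrrOdd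

open Literature.NumberTheory.ComplexMultiplication

universe w u v

variable {G : Type w} [Group G] {I : Type u} {E : I → Type v} [∀ i, MulAction G (E i)] [Fintype I]
  [∀ i, Fintype (E i)] [∀ i, Nonempty (E i)]

/-! ### §1 Abstract slots -/

/-- **ADDITIVITY SPLITS INTO BLOCKS AND IS INHERITED BY EVERY BLOCK.**  `G` permutes finite slots `E_i`, `Φ_i` are CM
types for `ρ`, `κ : I ↠ C` is a partition of the slots.  If the family is additive, `rank(Σ) + |I| = Σ_i rank(Φ_i) + 1`
(`Hg(∏_i A_i) = ∏_i Hg(A_i)`), then (1) `rank(Σ) + |C| = Σ_c rank(Σ|_c) + 1` (`Hg(∏_i A_i) = ∏_c Hg(∏_{κ i = c} A_i)`) and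
(2) every block family `(Φ_i)_{κ i = c}` is additive.  (Chain `rank(Σ) + |C| ≤ Σ_c rank(Σ|_c) + 1` with the sum over `c`
of `rank(Σ|_c) + |I_c| ≤ Σ_{I_c} rank(Φ_i) + 1`: the total is the additivity identity, so no link is strict.)
[cite: Gordon1999HodgeAVSurvey, 7.7] [cite: MoonenZarhin1999LowDim, §3 (3.1)] -/
theorem typeRank_sigmaType_fiber_add_card_eq_of_add_card_eq [Nonempty I] {C : Type*} [Fintype C] [DecidableEq C]
    {ρ : G} {Φ : ∀ i, Set (E i)} (h : ∀ i, IsCMTypeWith ρ (Φ i)) (κ : I → C) (hκ : Function.Surjective κ)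
    (hadd : typeRank G (sigmaType Φ) + Fintype.card I = (∑ i, typeRank G (Φ i)) + 1) :
    typeRank G (sigmaType Φ) + Fintype.card C =
        (∑ c, typeRank G (sigmaType fun i : {i // κ i = c} => Φ i.1)) + 1 ∧
      ∀ c, typeRank G (sigmaType fun i : {i // κ i = c} => Φ i.1) + Fintype.card {i // κ i = c} =
        (∑ i : {i // κ i = c}, typeRank G (Φ i.1)) + 1 := by
  haveI : ∀ c, Nonempty {i // κ i = c} := fun c => by
    obtain ⟨i, hi⟩ := hκ c
    exact ⟨⟨i, hi⟩⟩
  -- the two a-priori inequalities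
  have h1 := typeRank_sigmaType_add_card_le_fiber h κ hκ
  have h2 : ∀ c, typeRank G (sigmaType fun i : {i // κ i = c} => Φ i.1) + Fintype.card {i // κ i = c} ≤
      (∑ i : {i // κ i = c}, typeRank G (Φ i.1)) + 1 := fun c =>
    typeRank_sigmaType_add_card_le (E := fun i : {i // κ i = c} => E i.1) fun i => h i.1
  -- regrouping the members along the blocks
  have hcardI : ∑ c, Fintype.card {i // κ i = c} = Fintype.card I := by
    have h' := Fintype.sum_fiberwise κ fun _ : I => (1 : ℕ)
    simpa only [Finset.sum_const, Finset.card_univ, smul_eq_mul, mul_one] using h'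
  have hsumI : ∑ c, ∑ i : {i // κ i = c}, typeRank G (Φ i.1) = ∑ i, typeRank G (Φ i) :=
    Fintype.sum_fiberwise κ fun i => typeRank G (Φ i)
  have hsum2 : ∑ c, (typeRank G (sigmaType fun i : {i // κ i = c} => Φ i.1) + Fintype.card {i // κ i = c}) ≤
      ∑ c, ((∑ i : {i // κ i = c}, typeRank G (Φ i.1)) + 1) := Finset.sum_le_sum fun c _ => h2 c
  rw [Finset.sum_add_distrib, Finset.sum_add_distrib, hcardI, hsumI, Finset.sum_const, Finset.card_univ, smul_eq_mul,
    mul_one] at hsum2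
  refine ⟨by omega, fun c => ?_⟩
  by_contra hne
  have hlt : typeRank G (sigmaType fun i : {i // κ i = c} => Φ i.1) + Fintype.card {i // κ i = c} <
      (∑ i : {i // κ i = c}, typeRank G (Φ i.1)) + 1 := lt_of_le_of_ne (h2 c) hne
  have hsum_lt : ∑ c, (typeRank G (sigmaType fun i : {i // κ i = c} => Φ i.1) + Fintype.card {i // κ i = c}) <
      ∑ c, ((∑ i : {i // κ i = c}, typeRank G (Φ i.1)) + 1) :=
    Finset.sum_lt_sum (fun c _ => h2 c) ⟨c, Finset.mem_univ c, hlt⟩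
  rw [Finset.sum_add_distrib, Finset.sum_add_distrib, hcardI, hsumI, Finset.sum_const, Finset.card_univ, smul_eq_mul,
    mul_one] at hsum_lt
  omega

/-- **THE TWO-BLOCK FORM: `Hg(X × Y) = Hg(X) × Hg(Y)` for every splitting of an additive family.**  For a decidable
predicate `p` on the slots with both `{p}` and `{¬p}` non-empty, additivity of `(Φ_i)_i` gives
`rank(Σ|_p ⊔ Σ|_{¬p}) + 1 = rank(Σ|_p) + rank(Σ|_{¬p})` — the glued type of the two block families on the disjoint union of
their slots — together with the additivity of both block families.  This is the rank hypothesis under which the Hodge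
classes of `X × Y` (`X = ∏_{p i} A_i`, `Y = ∏_{¬ p i} A_i`, and all products of copies) are exterior products of Hodge
classes of the factors. [cite: MoonenZarhin1999LowDim, §3 (3.1)] [cite: Gordon1999HodgeAVSurvey, 7.7] -/
theorem typeRank_sum_add_one_eq_of_add_card_eq {ρ : G} {Φ : ∀ i, Set (E i)} (h : ∀ i, IsCMTypeWith ρ (Φ i))
    (p : I → Prop) [DecidablePred p] (hp : ∃ i, p i) (hnp : ∃ i, ¬p i)
    (hadd : typeRank G (sigmaType Φ) + Fintype.card I = (∑ i, typeRank G (Φ i)) + 1) :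
    typeRank G {z : (Σ i : {i // p i}, E i.1) ⊕ (Σ i : {i // ¬p i}, E i.1) |
        Sum.elim (· ∈ sigmaType fun i : {i // p i} => Φ i.1) (· ∈ sigmaType fun i : {i // ¬p i} => Φ i.1) z} + 1 =
      typeRank G (sigmaType fun i : {i // p i} => Φ i.1) + typeRank G (sigmaType fun i : {i // ¬p i} => Φ i.1) ∧
    typeRank G (sigmaType fun i : {i // p i} => Φ i.1) + Fintype.card {i // p i} =
      (∑ i : {i // p i}, typeRank G (Φ i.1)) + 1 ∧
    typeRank G (sigmaType fun i : {i // ¬p i} => Φ i.1) + Fintype.card {i // ¬p i} =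
      (∑ i : {i // ¬p i}, typeRank G (Φ i.1)) + 1 := by
  obtain ⟨i₁, hi₁⟩ := hp
  obtain ⟨i₂, hi₂⟩ := hnp
  haveI : Nonempty {i // p i} := ⟨⟨i₁, hi₁⟩⟩
  haveI : Nonempty {i // ¬p i} := ⟨⟨i₂, hi₂⟩⟩
  haveI : Nonempty (Σ i : {i // p i}, E i.1) := ⟨⟨⟨i₁, hi₁⟩, Classical.arbitrary (E i₁)⟩⟩
  haveI : Nonempty (Σ i : {i // ¬p i}, E i.1) := ⟨⟨⟨i₂, hi₂⟩, Classical.arbitrary (E i₂)⟩⟩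
  have hP : IsCMTypeWith ρ (sigmaType fun i : {i // p i} => Φ i.1) := IsCMTypeWith.sigmaType fun i => h i.1
  have hN : IsCMTypeWith ρ (sigmaType fun i : {i // ¬p i} => Φ i.1) := IsCMTypeWith.sigmaType fun i => h i.1
  -- the glued type of the two blocks is `Σ` read through the equivariant bijection onto `⊔_i E_i`
  set q : (Σ i : {i // p i}, E i.1) ⊕ (Σ i : {i // ¬p i}, E i.1) → Σ i, E i :=
    Sum.elim (fun x => ⟨x.1.1, x.2⟩) (fun x => ⟨x.1.1, x.2⟩) with hq
  have hq_smul : ∀ (g : G) (z : (Σ i : {i // p i}, E i.1) ⊕ (Σ i : {i // ¬p i}, E i.1)), q (g • z) = g • q z := by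
    intro g z
    rcases z with ⟨⟨i, hi⟩, s⟩ | ⟨⟨i, hi⟩, s⟩ <;> rfl
  have hq_surj : Function.Surjective q := by
    rintro ⟨i, s⟩
    by_cases hi : p i
    · exact ⟨Sum.inl ⟨⟨i, hi⟩, s⟩, rfl⟩
    · exact ⟨Sum.inr ⟨⟨i, hi⟩, s⟩, rfl⟩
  have hq_pre : q ⁻¹' sigmaType Φ = {z | Sum.elim (· ∈ sigmaType fun i : {i // p i} => Φ i.1)
      (· ∈ sigmaType fun i : {i // ¬p i} => Φ i.1) z} := by
    ext z
    rcases z with ⟨⟨i, hi⟩, s⟩ | ⟨⟨i, hi⟩, s⟩ <;> rfl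
  have hglue : typeRank G {z : (Σ i : {i // p i}, E i.1) ⊕ (Σ i : {i // ¬p i}, E i.1) |
      Sum.elim (· ∈ sigmaType fun i : {i // p i} => Φ i.1) (· ∈ sigmaType fun i : {i // ¬p i} => Φ i.1) z} =
      typeRank G (sigmaType Φ) := by
    rw [← hq_pre]
    exact typeRank_preimage_eq_of_surjective (G := G) (sigmaType Φ) q hq_smul hq_surj
  -- the three a-priori inequalities
  have hle := typeRank_sum_add_one_le hP hN
  have hP' : typeRank G (sigmaType fun i : {i // p i} => Φ i.1) + Fintype.card {i // p i} ≤
      (∑ i : {i // p i}, typeRank G (Φ i.1)) + 1 :=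
    typeRank_sigmaType_add_card_le (E := fun i : {i // p i} => E i.1) fun i => h i.1
  have hN' : typeRank G (sigmaType fun i : {i // ¬p i} => Φ i.1) + Fintype.card {i // ¬p i} ≤
      (∑ i : {i // ¬p i}, typeRank G (Φ i.1)) + 1 :=
    typeRank_sigmaType_add_card_le (E := fun i : {i // ¬p i} => E i.1) fun i => h i.1
  have hcard : Fintype.card {i // p i} + Fintype.card {i // ¬p i} = Fintype.card I := by
    have h' := Fintype.sum_subtype_add_sum_subtype p fun _ : I => (1 : ℕ)
    simpa only [Finset.sum_const, Finset.card_univ, smul_eq_mul, mul_one] using h'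
  have hsum : (∑ i : {i // p i}, typeRank G (Φ i.1)) + ∑ i : {i // ¬p i}, typeRank G (Φ i.1) =
      ∑ i, typeRank G (Φ i) := Fintype.sum_subtype_add_sum_subtype p fun i => typeRank G (Φ i)
  rw [hglue] at hle ⊢
  refine ⟨?_, ?_, ?_⟩ <;> omega

/-- **ADDITIVITY IS HEREDITARY**: every sub-family `(Φ_i)_{p i}` (non-empty) of an additive family is additive —
`Hg(∏_{i ∈ T} A_i) = ∏_{i ∈ T} Hg(A_i)` for every `T`, once it holds for `T = I`. [cite: Gordon1999HodgeAVSurvey, 7.7]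
[cite: MoonenZarhin1999LowDim, §3 (3.1)] -/
theorem typeRank_sigmaType_subtype_add_card_eq_of_add_card_eq {ρ : G} {Φ : ∀ i, Set (E i)}
    (h : ∀ i, IsCMTypeWith ρ (Φ i)) (p : I → Prop) [DecidablePred p] (hp : ∃ i, p i)
    (hadd : typeRank G (sigmaType Φ) + Fintype.card I = (∑ i, typeRank G (Φ i)) + 1) :
    typeRank G (sigmaType fun i : {i // p i} => Φ i.1) + Fintype.card {i // p i} =
      (∑ i : {i // p i}, typeRank G (Φ i.1)) + 1 := by
  by_cases hnp : ∃ i, ¬p i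
  · exact (typeRank_sum_add_one_eq_of_add_card_eq h p hp hnp hadd).2.1
  · -- `p` holds everywhere: the sub-family is the family, read through the bijection `{i // p i} ≃ I`
    push Not at hnp
    set q : (Σ i : {i // p i}, E i.1) → Σ i, E i := fun x => ⟨x.1.1, x.2⟩ with hq
    have hq_smul : ∀ (g : G) (x : Σ i : {i // p i}, E i.1), q (g • x) = g • q x := fun g x => rfl
    have hq_surj : Function.Surjective q := fun y => ⟨⟨⟨y.1, hnp y.1⟩, y.2⟩, rfl⟩
    have hq_pre : q ⁻¹' sigmaType Φ = sigmaType fun i : {i // p i} => Φ i.1 := rfl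
    have hrank : typeRank G (sigmaType fun i : {i // p i} => Φ i.1) = typeRank G (sigmaType Φ) := by
      rw [← hq_pre]
      exact typeRank_preimage_eq_of_surjective (G := G) (sigmaType Φ) q hq_smul hq_surj
    have hcard : Fintype.card {i // p i} = Fintype.card I := Fintype.card_congr (Equiv.subtypeUnivEquiv hnp)
    have hsum : ∑ i : {i // p i}, typeRank G (Φ i.1) = ∑ i, typeRank G (Φ i) :=
      Fintype.sum_equiv (Equiv.subtypeUnivEquiv hnp) (fun i : {i // p i} => typeRank G (Φ i.1))
        (fun i => typeRank G (Φ i)) fun _ => rfl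
    rw [hrank, hcard, hsum, hadd]

end IrrOdd

/-! ### §2 CM fields -/

open Literature.NumberTheory.ComplexMultiplication
open Literature.AlgebraicGeometry.Motives (CMType)
open Literature.AlgebraicGeometry.Pohlmann1968

variable {I : Type} [Fintype I] {K : I → Type} [∀ i, Field (K i)] [∀ i, NumberField (K i)] [∀ i, IsCMField (K i)]

/-- **`Hg(∏_i A_i) = ∏_i Hg(A_i)` ⟹ `Hg(∏_i A_i) = ∏_c Hg(∏_{κ i = c} A_i)` and `Hg(∏_{κ i = c} A_i) = ∏_{κ i = c} Hg(A_i)`**: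
an additive family of CM types (`cmFamilyRank Φ + |I| = Σ_i cmTypeRank Φ_i + 1`, members arbitrary) is additive over the
blocks of every partition `κ : I ↠ C`, and every block sub-family is additive.
[cite: Gordon1999HodgeAVSurvey, 7.7] [cite: MoonenZarhin1999LowDim, §3 (3.1)] -/
theorem cmFamilyRank_fiber_add_card_eq_of_add_card_eq [Nonempty I] {C : Type} [Fintype C] [DecidableEq C]
    (Φ : ∀ i, CMType (K i)) (κ : I → C) (hκ : Function.Surjective κ)
    (hadd : CMAlgebra.cmFamilyRank Φ + Fintype.card I = (∑ i, cmTypeRank (Φ i)) + 1) :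
    CMAlgebra.cmFamilyRank Φ + Fintype.card C =
        (∑ c, CMAlgebra.cmFamilyRank fun i : {i // κ i = c} => Φ i.1) + 1 ∧
      ∀ c, CMAlgebra.cmFamilyRank (fun i : {i // κ i = c} => Φ i.1) + Fintype.card {i // κ i = c} =
        (∑ i : {i // κ i = c}, cmTypeRank (Φ i.1)) + 1 :=
  IrrOdd.typeRank_sigmaType_fiber_add_card_eq_of_add_card_eq (G := ℂ ≃+* ℂ) (E := fun i => K i →+* ℂ)
    (Φ := fun i => (Φ i).1) (fun i => isCMTypeWith_conj (Φ i)) κ hκ hadd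

/-- **Additivity is hereditary for CM fields**: if `cmFamilyRank Φ + |I| = Σ_i cmTypeRank Φ_i + 1` then the same holds for
every non-empty sub-family `(Φ_i)_{p i}` (`Hg(∏_{p i} A_i) = ∏_{p i} Hg(A_i)`). [cite: Gordon1999HodgeAVSurvey, 7.7] -/
theorem cmFamilyRank_subtype_add_card_eq_of_add_card_eq (Φ : ∀ i, CMType (K i)) (p : I → Prop) [DecidablePred p]
    (hp : ∃ i, p i) (hadd : CMAlgebra.cmFamilyRank Φ + Fintype.card I = (∑ i, cmTypeRank (Φ i)) + 1) :
    CMAlgebra.cmFamilyRank (fun i : {i // p i} => Φ i.1) + Fintype.card {i // p i} =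
      (∑ i : {i // p i}, cmTypeRank (Φ i.1)) + 1 :=
  IrrOdd.typeRank_sigmaType_subtype_add_card_eq_of_add_card_eq (G := ℂ ≃+* ℂ) (E := fun i => K i →+* ℂ)
    (Φ := fun i => (Φ i).1) (fun i => isCMTypeWith_conj (Φ i)) p hp hadd

/-- **The two-block form for CM fields**: for an additive family and a predicate `p` with `{p}`, `{¬p}` non-empty, the
glued type of the two block families satisfies `rank(Σ|_p ⊔ Σ|_{¬p}) + 1 = cmFamilyRank Φ|_p + cmFamilyRank Φ|_{¬p}` —
`Hg(X × Y) = Hg(X) × Hg(Y)` for `X = ∏_{p i} A_i`, `Y = ∏_{¬p i} A_i` — the hypothesis of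
`Pohlmann1968.hodgeClassesProductSpan_biproduct_of_typeRank_add`. [cite: MoonenZarhin1999LowDim, §3 (3.1)] [cite: Gordon1999HodgeAVSurvey, 7.7] -/
theorem typeRank_sum_add_one_eq_cmFamilyRank_of_add_card_eq (Φ : ∀ i, CMType (K i)) (p : I → Prop)
    [DecidablePred p] (hp : ∃ i, p i) (hnp : ∃ i, ¬p i)
    (hadd : CMAlgebra.cmFamilyRank Φ + Fintype.card I = (∑ i, cmTypeRank (Φ i)) + 1) :
    typeRank (ℂ ≃+* ℂ) {z : (Σ i : {i // p i}, (K i.1 →+* ℂ)) ⊕ (Σ i : {i // ¬p i}, (K i.1 →+* ℂ)) |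
        Sum.elim (· ∈ CMAlgebra.familyType fun i : {i // p i} => Φ i.1)
          (· ∈ CMAlgebra.familyType fun i : {i // ¬p i} => Φ i.1) z} + 1 =
      CMAlgebra.cmFamilyRank (fun i : {i // p i} => Φ i.1) + CMAlgebra.cmFamilyRank (fun i : {i // ¬p i} => Φ i.1) :=
  (IrrOdd.typeRank_sum_add_one_eq_of_add_card_eq (G := ℂ ≃+* ℂ) (E := fun i => K i →+* ℂ) (Φ := fun i => (Φ i).1)
    (fun i => isCMTypeWith_conj (Φ i)) p hp hnp hadd).1

end Literature.AlgebraicGeometry.ComplexMultiplication.BlockAdditivity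

end
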